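import Literature.NumberTheory.NumberFields.CyclicQuinticField241Units
import Literature.NumberTheory.NumberFields.SelmerGroupPID
import Literature.NumberTheory.EllipticCurves.TwoDescentLocalImageMod8
import Literature.NumberTheory.EllipticCurves.TwoDescentParity
import HarnessLib

/-!
# The cyclic quintic field of conductor `241` (`2` split): the norm-`1` `2`-descent of `480a1`

Seventh file on `K = K₂₄₁ = ℚ(η₀)` (`CyclicQuinticField241*.lean`: `𝓞 K = ⊕ ℤηₖ`, `Gal = ⟨σ⟩`,
class number one, the reductions `ρ s : 𝓞 K → ℤ/8`, units modulo squares `{rep n}`, real signs).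
Here `2 = 𝔭₀𝔭₁𝔭₂𝔭₃𝔭₄` SPLITS COMPLETELY (`2⁴⁸ ≡ 1 mod 241`), so the `2`-adic information lives in
five copies of `ℚ₂` and is read off through `ρ 0, …, ρ 4` with the generic bookkeeping of
`Literature/NumberTheory/EllipticCurves/TwoDescentLocalImageMod8.lean` (`Mod8Prime.LocQ`,
`Mod8Prime.localImage`), exactly as in the tree's `CyclicCubicField1339ADescent.lean`. We prove
(`normDescent`): for every `K`-point `(x, y)`, `y ≠ 0`, of `E : y² = x(x + 2)(x - 3)` (`480a1`) with
`N_{K/ℚ}(x)`, `N_{K/ℚ}(x + 2) ∈ ℚˣ²`, both `x` and `x + 2` are squares in `K`; and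
(`normDescent_of_root`) the same over any quintic extension of `ℚ` generated by a root of
`f = X⁵ + X⁴ - 96X³ - 212X² + 1232X + 512`.

## Proof

* `π = 107η₀ + 115η₁ + 93η₂ + 94η₃ + 97η₄` has norm `-2`; its conjugates `πᵢ = σⁱπ` generate the five
  primes above `2` (`πᵢ ∈ 𝔭_{1-i}`), `π₀π₁π₂π₃π₄ = -2`. The `2`-adic classes `(ord, residue mod 8)` of
  the `πᵢ` and of the unit representatives `rep n` at `𝔭ₛ` are certified through `ρ s`
  (`Mod8Prime.locQ_of_mul_eq`; all residues are kernel evaluations in the order of periods).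
* For a point, the classes `(nₛ, rₛ)` of `x` at `𝔭ₛ` satisfy `Σ nₛ ≡ 0 (mod 2)` (`N(x) = ∏ σᵏx` is a
  rational square and `ρ s ∘ σᵏ = ρ (s + k)`), so `x/γ`, `γ = ∏ πᵢ^{cᵢ}` (`cᵢ ≡ n_{1-i}`), has even
  valuation at the `𝔭ₛ`; at `(3)`, `(5)` (inert) by `N(x) = □` (`σ`-invariance of the valuation), and at
  all other primes by the parity lemma. As `h(K) = 1`, `x = rep n · γ · A²`; `N(x) ∈ ℚˣ²` forces
  `rep n` to have norm `1` (no `-1`) and `Σ cᵢ` even; likewise `x + 2 = rep n' · γ' · B²`, and `x + 2`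
  is totally positive.
* `Mod8Prime.localImage` at `𝔭₀, …, 𝔭₄` puts the pair of classes in `W⁵`; together with the sign
  condition a `decide` over the exponent patterns leaves only the trivial one (`final_check`):
  `x = A²`, `x + 2 = B²`.

Everything is proved (kernel-checked computations by `decide`); no named facts are introduced.

## References

* T. Dokchitser, V. Dokchitser, *A note on the Mordell–Weil rank modulo `n`*, J. Number Theory 131
  (2011) 1833–1839: proof of Thm. 2 ("2-descent shows that rk E/F₅ = 1 (e.g. using Magma, over all
  minimal non-trivial subfields of Fₙ)"). [DokchitserDokchitser2011RankModN]
* J. H. Silverman, *The Arithmetic of Elliptic Curves*, 2nd ed., GTM 106 (2009): Prop. X.1.4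
  (complete `2`-descent), §X.1. [cite: SilvermanAEC2009, Prop. X.1.4]
-/

noncomputable section

open Polynomial NumberField Algebra Ideal IsDedekindDomain IsDedekindDomain.HeightOneSpectrum
open Literature.NumberTheory.EllipticCurves Literature.NumberTheory.EllipticCurves.Mod8Prime
open scoped WithZero

namespace Literature.NumberTheory.NumberFields

namespace CyclicQuintic241

open PeriodRing241 (eta shift const normP trP)

/-! ### Transport of `2`-adic classes along `σ` -/

/-- **Transport of classes along `σ`**: the class of `σ z` at `𝔭_ρ'` is the class of `z` at
`𝔭_{ρ' ∘ σ}`. (Verbatim the tree's `CyclicCubic1339A.locQ_σ`.) [folklore] -/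
theorem locQ_σ {ρ' : 𝓞 K →+* ZMod 8} {z : K} {n : ℤ} {r : ZMod 8}
    (h : LocQ (ρ'.comp σint.toRingHom) z n r) : LocQ ρ' (σ z) n r := by
  obtain ⟨u, s, hu, hs, hr, e⟩ := h
  refine ⟨σint u, σint s, ?_, ?_, ?_, ?_⟩
  · rw [not_mem_ideal_iff] at hu ⊢; exact hu
  · rw [not_mem_ideal_iff] at hs ⊢; exact hs
  · rw [← map_mul]; exact hr
  · have e' := congrArg σ e
    rw [map_mul, map_mul, map_zpow₀, map_ofNat] at e'
    exact e'

/-- `ρ s ∘ σ = ρ (s + 1)` as ring homomorphisms. [folklore] -/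
theorem ρ_comp_σint (s : Fin 5) : (ρ s).comp σint.toRingHom = ρ (s + 1) :=
  RingHom.ext (ρ_σint s)

/-- The class of `σ z` at `𝔭ₛ` is the class of `z` at `𝔭ₛ₊₁`. [folklore] -/
theorem locQ_σ' {s : Fin 5} {z : K} {n : ℤ} {r : ZMod 8} (h : LocQ (ρ (s + 1)) z n r) :
    LocQ (ρ s) (σ z) n r :=
  locQ_σ (by rw [ρ_comp_σint]; exact h)

/-- The class of `σᵏ z` at `𝔭ₛ` is the class of `z` at `𝔭ₛ₊ₖ`. [folklore] -/
theorem locQ_σ_iterate (k : Fin 5) {s : Fin 5} {z : K} {n : ℤ} {r : ZMod 8}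
    (h : LocQ (ρ (s + k)) z n r) : LocQ (ρ s) (σ^[(k : ℕ)] z) n r := by
  fin_cases k
  · simpa using h
  · exact locQ_σ' (by simpa using h)
  · show LocQ (ρ s) (σ^[2] z) n r
    simp only [Function.iterate_succ_apply', Function.iterate_zero_apply]
    exact locQ_σ' (locQ_σ' (by rwa [show (s + 1 + 1 : Fin 5) = s + 2 by omega]))
  · show LocQ (ρ s) (σ^[3] z) n r
    simp only [Function.iterate_succ_apply', Function.iterate_zero_apply]
    exact locQ_σ' (locQ_σ' (locQ_σ' (by rwa [show (s + 1 + 1 + 1 : Fin 5) = s + 3 by omega])))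
  · show LocQ (ρ s) (σ^[4] z) n r
    simp only [Function.iterate_succ_apply', Function.iterate_zero_apply]
    exact locQ_σ' (locQ_σ' (locQ_σ' (locQ_σ'
      (by rwa [show (s + 1 + 1 + 1 + 1 : Fin 5) = s + 4 by omega]))))

/-! ### The element `π` of norm `-2` and its conjugates -/

/-- **`π = 107η₀ + 115η₁ + 93η₂ + 94η₃ + 97η₄`**, of norm `-2`, in the order of periods. [folklore] -/
def πP : PeriodRing241 ℤ := ⟨107, 115, 93, 94, 97⟩

/-- The product `σπ · σ²π · σ³π · σ⁴π = 654η₀ + 826η₁ + 768η₂ + 927η₃ + 940η₄`. [folklore] -/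
def πcoP : PeriodRing241 ℤ := ⟨654, 826, 768, 927, 940⟩

/-- `πcoP` is the product of the four non-trivial conjugates of `π` (kernel identity). [folklore] -/
theorem πcoP_eq : shift^[1] πP * shift^[2] πP * shift^[3] πP * shift^[4] πP = πcoP := by
  decide +kernel

/-- Iterates of `shift` are powers in the monoid of ring endomorphisms. [folklore] -/
theorem shift_iterate_eq_pow (n : ℕ) (y : PeriodRing241 ℤ) : shift^[n] y = (shift ^ n) y := by
  rw [RingHom.coe_pow]

/-- **`π · (σπ σ²π σ³π σ⁴π) = -2`** (kernel identity). [folklore] -/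
theorem πP_mul_πcoP : πP * πcoP = -2 := by
  decide +kernel

/-- `N(π) = -2`. [folklore] -/
theorem normP_πP : normP πP = const (-2) := by
  decide +kernel

/-- **The conjugates `πᵢ = σⁱ π ∈ 𝓞 K`**, `i < 5`. [folklore] -/
def πO (i : Fin 5) : 𝓞 K := liftO (shift^[(i : ℕ)] πP)

/-- The cofactors `σⁱ(πcoP)`. [folklore] -/
def πcoO (i : Fin 5) : 𝓞 K := liftO (shift^[(i : ℕ)] πcoP)

/-- `πᵢ · (cofactor) = -2`. [folklore] -/
theorem πO_mul_πcoO (i : Fin 5) : πO i * πcoO i = -2 := by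
  rw [πO, πcoO, ← map_mul, shift_iterate_eq_pow, shift_iterate_eq_pow, ← map_mul, πP_mul_πcoP, map_neg,
    map_ofNat, map_neg, map_ofNat]

/-- `πᵢ = σⁱ π` in `K`. [folklore] -/
theorem coe_πO (i : Fin 5) : ((πO i : 𝓞 K) : K) = σ^[(i : ℕ)] (liftK πP) := by
  rw [πO, coe_liftO, σ_iterate_liftK]

/-- `πᵢ = σⁱ π₀` in `𝓞 K`. [folklore] -/
theorem πO_eq_σint_iterate (i : Fin 5) : πO i = σint^[(i : ℕ)] (πO 0) := by
  rw [πO, πO, σint_iterate_liftO]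
  rfl

/-- **`π₀π₁π₂π₃π₄ = -2`.** [folklore] -/
theorem prod_πO : πO 0 * πO 1 * πO 2 * πO 3 * πO 4 = -2 := by
  have h : πO 1 * πO 2 * πO 3 * πO 4 = πcoO 0 := by
    show liftO (shift^[1] πP) * liftO (shift^[2] πP) * liftO (shift^[3] πP) * liftO (shift^[4] πP) =
      liftO (shift^[0] πcoP)
    rw [← map_mul, ← map_mul, ← map_mul, πcoP_eq]
    rfl
  calc πO 0 * πO 1 * πO 2 * πO 3 * πO 4 = πO 0 * (πO 1 * πO 2 * πO 3 * πO 4) := by ring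
    _ = πO 0 * πcoO 0 := by rw [h]
    _ = -2 := πO_mul_πcoO 0

/-- `N(πᵢ) = -2`. [folklore] -/
theorem norm_πO (i : Fin 5) : Algebra.norm ℚ ((πO i : 𝓞 K) : K) = -2 := by
  rw [coe_πO, ← σ_pow_apply, Algebra.norm_eq_of_algEquiv, norm_liftK_of_normP_eq normP_πP]
  norm_num

/-! ### Residues of `π` and its cofactor; the `2`-adic classes of `πᵢ` and of units -/

/-- The residues of `π` along `𝔭₀, …, 𝔭₄`: `(5, 6, 5, 5, 1)` (`π ∈ 𝔭₁`). [folklore] -/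
def πres : Fin 5 → ZMod 8 := ![5, 6, 5, 5, 1]

/-- The residues of the cofactor along `𝔭₀, …, 𝔭₄`: `(6, 5, 6, 6, 6)`. [folklore] -/
def πcores : Fin 5 → ZMod 8 := ![6, 5, 6, 6, 6]

/-- `ρ s (σⁱ π) = πres (s + i)` (kernel computation). [folklore] -/
theorem ρP_shift_iterate_πP : ∀ s i : Fin 5, ρP s (shift^[(i : ℕ)] πP) = πres (s + i) := by
  decide +kernel

/-- `ρ s (σⁱ cofactor) = πcores (s + i)` (kernel computation). [folklore] -/
theorem ρP_shift_iterate_πcoP : ∀ s i : Fin 5, ρP s (shift^[(i : ℕ)] πcoP) = πcores (s + i) := by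
  decide +kernel

/-- `ρ s (πᵢ) = πres (s + i)`. [folklore] -/
theorem ρ_πO (s i : Fin 5) : ρ s (πO i) = πres (s + i) := by
  rw [πO, ρ_liftO, ρP_shift_iterate_πP]

/-- `ρ s (cofactorᵢ) = πcores (s + i)`. [folklore] -/
theorem ρ_πcoO (s i : Fin 5) : ρ s (πcoO i) = πcores (s + i) := by
  rw [πcoO, ρ_liftO, ρP_shift_iterate_πcoP]

/-- The residues `πres t`, `t ≠ 1`, are odd; `πcores 1 = 5` is odd. [folklore] -/
theorem isOdd_πres : ∀ t : Fin 5, t ≠ 1 → IsOdd (πres t) := by decide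

/-- An element of odd residue is a `𝔭`-unit of class `(0, ρ)`. [folklore] -/
theorem locQ_of_isOdd (ρ' : 𝓞 K →+* ZMod 8) {u : 𝓞 K} (h : IsOdd (ρ' u)) :
    LocQ ρ' ((u : 𝓞 K) : K) 0 (ρ' u) :=
  (locU_coe ((not_mem_ideal_iff ρ').mpr h)).locQ

/-- The `2`-adic order of `πᵢ` at `𝔭ₛ`: `1` if `s + i = 1`, else `0`. [folklore] -/
def πord (s i : Fin 5) : ℤ := if s + i = 1 then 1 else 0

/-- The `2`-adic residue class of `πᵢ` at `𝔭ₛ`: `-πcores 1 = 3` if `s + i = 1`, else `πres (s + i)`.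
[folklore] -/
def πcls (s i : Fin 5) : ZMod 8 := if s + i = 1 then -πcores 1 else πres (s + i)

/-- **The class of `πᵢ` at `𝔭ₛ`** is `(πord s i, πcls s i)`: at its own prime (`s + i = 1`) from
`πᵢ · cofactor = 2 · (-1)`, elsewhere a unit of residue `πres (s + i)`. [folklore] -/
theorem locQ_πO (s i : Fin 5) : LocQ (ρ s) ((πO i : 𝓞 K) : K) (πord s i) (πcls s i) := by
  by_cases h : s + i = 1
  · rw [πord, πcls, if_pos h, if_pos h]
    have hu : (-1 : 𝓞 K) ∉ ideal (ρ s) := by rw [not_mem_ideal_iff, map_neg, map_one]; decide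
    have hs : πcoO i ∉ ideal (ρ s) := by
      rw [not_mem_ideal_iff, ρ_πcoO, h]; decide
    have key := locQ_of_mul_eq (ρ := ρ s) (z := ((πO i : 𝓞 K) : K)) (k := 1) hu hs (by
      rw [← map_mul, πO_mul_πcoO, map_neg, map_ofNat, map_neg, map_one, pow_one]; ring)
    rw [map_mul, map_neg, map_one, ρ_πcoO, h, neg_one_mul, Nat.cast_one] at key
    exact key
  · rw [πord, πcls, if_neg h, if_neg h]
    have hodd : IsOdd (ρ s (πO i)) := by rw [ρ_πO]; exact isOdd_πres _ h
    have := locQ_of_isOdd (ρ s) hodd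
    rwa [ρ_πO] at this

/-- Units of `ℤ/8` are odd residues. [folklore] -/
theorem isOdd_units_zmod8 : ∀ U : (ZMod 8)ˣ, IsOdd (U : ZMod 8) := by decide

/-- **The class of a unit at `𝔭ₛ` is `(0, ρ s u)`.** [folklore] -/
theorem locQ_unit (s : Fin 5) (u : (𝓞 K)ˣ) : LocQ (ρ s) (((u : 𝓞 K)) : K) 0 (ρ s (u : 𝓞 K)) :=
  locQ_of_isOdd (ρ s) (by
    have := isOdd_units_zmod8 (Units.map (ρ s : 𝓞 K →* ZMod 8) u)
    simpa using this)

/-- The class of `rep n` at `𝔭ₛ` is `(0, dsigOf n s)`. [folklore] -/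
theorem locQ_rep (s : Fin 5) (n : Fin 32) : LocQ (ρ s) (((rep n : (𝓞 K)ˣ) : 𝓞 K) : K) 0 (dsigOf n s) := by
  have h := locQ_unit s (rep n)
  rwa [show ρ s ((rep n : (𝓞 K)ˣ) : 𝓞 K) = dsig (rep n) s from rfl, dsig_rep] at h

/-- Powers of classes. (Verbatim the tree's `CyclicCubic1339A.locQ_pow`.) [folklore] -/
theorem locQ_pow {ρ' : 𝓞 K →+* ZMod 8} {z : K} {n : ℤ} {r : ZMod 8} (h : LocQ ρ' z n r) :
    ∀ e : ℕ, LocQ ρ' (z ^ e) (e * n) (r ^ e)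
  | 0 => by simpa using (locU_one (ρ := ρ')).locQ
  | (e + 1) => by
      have h' := (locQ_pow h e).mul h
      rw [← pow_succ, ← pow_succ] at h'
      convert h' using 2
      push_cast; ring

/-- Classes of finite products. [folklore] -/
theorem locQ_prod {ρ' : 𝓞 K →+* ZMod 8} {ι : Type*} (t : Finset ι) {f : ι → K} {n : ι → ℤ}
    {r : ι → ZMod 8} (h : ∀ i ∈ t, LocQ ρ' (f i) (n i) (r i)) :
    LocQ ρ' (∏ i ∈ t, f i) (∑ i ∈ t, n i) (∏ i ∈ t, r i) := by
  classical
  induction t using Finset.induction_on with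
  | empty => simpa using (locU_one (ρ := ρ')).locQ
  | insert a t ha ih =>
    rw [Finset.prod_insert ha, Finset.sum_insert ha, Finset.prod_insert ha]
    exact (h a (Finset.mem_insert_self a t)).mul (ih fun i hi => h i (Finset.mem_insert_of_mem hi))

/-! ### The candidates `rep n · ∏ πᵢ^{cᵢ}` and their classes -/

/-- **The candidates** `cand n c = rep n · ∏ᵢ πᵢ^{bit c i}` (`n, c < 32`). [folklore] -/
def cand (n c : Fin 32) : 𝓞 K := ((rep n : (𝓞 K)ˣ) : 𝓞 K) * ∏ i : Fin 5, πO i ^ bit c i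

/-- The candidates in `K`. [folklore] -/
theorem coe_cand (n c : Fin 32) : ((cand n c : 𝓞 K) : K) =
    (((rep n : (𝓞 K)ˣ) : 𝓞 K) : K) * ∏ i : Fin 5, ((πO i : 𝓞 K) : K) ^ bit c i := by
  simp only [cand, map_mul, map_prod, map_pow]

/-- The `2`-adic order of `cand n c` at `𝔭ₛ`. [folklore] -/
def ordOf (c : Fin 32) (s : Fin 5) : ℤ := ∑ i : Fin 5, (bit c i : ℤ) * πord s i

/-- The `2`-adic residue of `cand n c` at `𝔭ₛ`. [folklore] -/
def resOf (n c : Fin 32) (s : Fin 5) : ZMod 8 := dsigOf n s * ∏ i : Fin 5, πcls s i ^ bit c i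

/-- **The class of `cand n c` at `𝔭ₛ` is `(ordOf c s, resOf n c s)`.** [folklore] -/
theorem locQ_cand (n c : Fin 32) (s : Fin 5) :
    LocQ (ρ s) ((cand n c : 𝓞 K) : K) (ordOf c s) (resOf n c s) := by
  have h := (locQ_rep s n).mul (locQ_prod (ρ' := ρ s) Finset.univ
    (f := fun i => ((πO i : 𝓞 K) : K) ^ bit c i) (n := fun i => (bit c i : ℤ) * πord s i)
    (r := fun i => πcls s i ^ bit c i) fun i _ => locQ_pow (locQ_πO s i) (bit c i))
  rw [zero_add] at h
  rw [coe_cand]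
  exact h

/-! ### The real signs of the candidates -/

/-- The sign vector of an element of `K` at the five real embeddings. [folklore] -/
def sgn5 (z : K) : Fin 5 → SignType := fun s => SignType.sign (emb s z)

/-- `sgn5` is multiplicative. [folklore] -/
theorem sgn5_mul (z z' : K) : sgn5 (z * z') = sgn5 z * sgn5 z' := by
  ext s; simp only [sgn5, map_mul, sign_mul, Pi.mul_apply]

/-- `sgn5 1 = 1`. [folklore] -/
theorem sgn5_one : sgn5 (1 : K) = 1 := by
  ext s; simp [sgn5]

/-- `sgn5` as a monoid homomorphism. [folklore] -/
def sgn5Hom : K →* (Fin 5 → SignType) where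
  toFun := sgn5
  map_one' := sgn5_one
  map_mul' := sgn5_mul

/-- `sgn5Hom` is `sgn5`. [folklore] -/
@[simp] theorem sgn5Hom_apply (z : K) : sgn5Hom z = sgn5 z := rfl

/-- Squares of non-zero elements are totally positive. [folklore] -/
theorem sgn5_sq {B : K} (hB : B ≠ 0) : sgn5 (B ^ 2) = 1 := by
  ext s
  simp only [sgn5, map_pow, Pi.one_apply]
  exact sign_pos (lt_of_le_of_ne (sq_nonneg _) (Ne.symm (pow_ne_zero 2 ((_root_.map_ne_zero _).mpr hB))))

/-- The signs of `v` at `emb 0, …, emb 4`: `(-, -, +, +, +)`. [folklore] -/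
def vsgn : Fin 5 → SignType := ![-1, -1, 1, 1, 1]

/-- The signs of `π` at `emb 0, …, emb 4`: `(+, -, -, -, +)`. [folklore] -/
def πsgn : Fin 5 → SignType := ![1, -1, -1, -1, 1]

/-- `sign (emb s v) = vsgn s`. [folklore] -/
theorem sign_emb_vP (s : Fin 5) : SignType.sign (emb s (liftK vP)) = vsgn s := by
  obtain ⟨h0, h1, h2, h3, h4⟩ := sign_emb_v
  fin_cases s
  · exact sign_neg h0
  · exact sign_neg h1
  · exact sign_pos h2
  · exact sign_pos h3
  · exact sign_pos h4

/-- **The signs of `π`**: `emb s π` is `> 0` for `s = 0, 4` and `< 0` for `s = 1, 2, 3` (interval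
arithmetic on `Σ πₖ r_{s+k}`; the smallest, `emb 0 π ≈ 4.9·10⁻⁴`, is still `≫ 10⁻⁵`). [folklore] -/
theorem sign_emb_πP (s : Fin 5) : SignType.sign (emb s (liftK πP)) = πsgn s := by
  have h0 := r₀_spec.1; have h1 := r₁_spec.1; have h2 := r₂_spec.1; have h3 := r₃_spec.1
  have h4 := r₄_spec.1
  simp only [Set.mem_Ioo] at h0 h1 h2 h3 h4
  fin_cases s
  · refine sign_pos ?_
    rw [emb_liftK]; simp [πP, r, Fin.isValue]; linarith
  · refine sign_neg ?_
    rw [emb_liftK]; simp [πP, r, Fin.isValue]; linarith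
  · refine sign_neg ?_
    rw [emb_liftK]; simp [πP, r, Fin.isValue]; linarith
  · refine sign_neg ?_
    rw [emb_liftK]; simp [πP, r, Fin.isValue]; linarith
  · refine sign_pos ?_
    rw [emb_liftK]; simp [πP, r, Fin.isValue]; linarith

/-- `sgn5 (σⁱ v) s = vsgn (s + i)`. [folklore] -/
theorem sgn5_unitv (i s : Fin 5) : sgn5 (((unitv i : (𝓞 K)ˣ) : 𝓞 K) : K) s = vsgn (s + i) := by
  rw [sgn5, coe_unitv, coe_liftO, ← σ_iterate_liftK, emb_σ_iterate, sign_emb_vP]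

/-- `sgn5 (πᵢ) s = πsgn (s + i)`. [folklore] -/
theorem sgn5_πO (i s : Fin 5) : sgn5 ((πO i : 𝓞 K) : K) s = πsgn (s + i) := by
  rw [sgn5, coe_πO, emb_σ_iterate, sign_emb_πP]

/-- `sgn5 (-1) = -1`. [folklore] -/
theorem sgn5_neg_one : sgn5 (-1 : K) = -1 := by
  ext s; simp [sgn5]

/-- The predicted sign vector of `cand n c` (computable). [folklore] -/
def sgnOf (n c : Fin 32) (s : Fin 5) : SignType :=
  (-1) ^ bit n 4 * (∏ i : Fin 4, vsgn (s + Fin.castSucc i) ^ bit n (Fin.castSucc i)) *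
    ∏ i : Fin 5, πsgn (s + i) ^ bit c i

/-- **`sgn5 (cand n c) = sgnOf n c`.** [folklore] -/
theorem sgn5_cand (n c : Fin 32) : sgn5 ((cand n c : 𝓞 K) : K) = sgnOf n c := by
  ext s
  rw [coe_cand, rep]
  simp only [Units.val_mul, Units.val_pow_eq_pow_val, Units.val_neg, Units.val_one, map_mul, map_pow,
    map_neg, map_one, Units.coe_prod, map_prod]
  rw [← sgn5Hom_apply, map_mul, map_mul, map_pow, map_prod, map_prod]
  simp only [map_pow, sgn5Hom_apply, sgn5_neg_one, Pi.mul_apply, Pi.pow_apply, Finset.prod_apply,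
    Pi.neg_apply, Pi.one_apply, sgn5_unitv, sgn5_πO, sgnOf]

/-! ### The five primes above `2`; valuations of `πᵢ` away from `2` -/

/-- The prime `(πᵢ)` is the prime `𝔭_{1-i}` of `ρ (1 - i)`. [folklore] -/
theorem span_πO_eq (i : Fin 5) : span {πO i} = ideal (ρ (1 - i)) := by
  have hN : absNorm (span {πO i}) = 2 := by
    rw [absNorm_span_singleton]
    have h := Algebra.coe_norm_int (πO i)
    rw [norm_πO] at h
    have h' : Algebra.norm ℤ (πO i) = -2 := by exact_mod_cast h
    rw [h']; rfl
  haveI : (span {πO i}).IsPrime := isPrime_of_irreducible_absNorm (hN ▸ Nat.prime_two)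
  have hne : span {πO i} ≠ ⊥ := by
    intro h; rw [h, absNorm_bot] at hN; exact absurd hN (by norm_num)
  have hmax : (span {πO i}).IsMaximal := Ring.DimensionLEOne.maximalOfPrime hne inferInstance
  refine hmax.eq_of_le (isMaximal_ideal _).ne_top ?_
  rw [span_singleton_le_iff_mem, mem_ideal_iff, ρ_πO, sub_add_cancel]
  decide

/-- **A finite place above `2` is one of `𝔭₀, …, 𝔭₄`**: `2 = -∏ πᵢ`, so a prime containing `2`
contains some `πᵢ`, hence equals `(πᵢ) = 𝔭_{1-i}`. [folklore] -/
theorem exists_eq_prime_of_two_mem {v : HeightOneSpectrum (𝓞 K)} (h2 : (2 : 𝓞 K) ∈ v.asIdeal) :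
    ∃ s : Fin 5, v = prime (ρ s) := by
  haveI := v.isPrime
  have hprod : πO 0 * πO 1 * πO 2 * πO 3 * πO 4 ∈ v.asIdeal := by
    rw [prod_πO]; exact v.asIdeal.neg_mem_iff.mpr h2
  have hmem : ∃ i : Fin 5, πO i ∈ v.asIdeal := by
    rcases v.isPrime.mem_or_mem hprod with h | h
    · rcases v.isPrime.mem_or_mem h with h | h
      · rcases v.isPrime.mem_or_mem h with h | h
        · rcases v.isPrime.mem_or_mem h with h | h
          · exact ⟨0, h⟩
          · exact ⟨1, h⟩
        · exact ⟨2, h⟩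
      · exact ⟨3, h⟩
    · exact ⟨4, h⟩
  obtain ⟨i, hi⟩ := hmem
  refine ⟨1 - i, HeightOneSpectrum.ext ?_⟩
  have hle : ideal (ρ (1 - i)) ≤ v.asIdeal := by
    rw [← span_πO_eq, span_singleton_le_iff_mem]; exact hi
  exact ((isMaximal_ideal _).eq_of_le v.isPrime.ne_top hle).symm

/-- For a natural number `n` and a finite place `v`: `v(n) = 1 ↔ n ∉ v`. [folklore] -/
theorem valuation_natCast_eq_one_iff (v : HeightOneSpectrum (𝓞 K)) (n : ℕ) :
    v.valuation K (n : K) = 1 ↔ (n : 𝓞 K) ∉ v.asIdeal := by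
  rw [show (n : K) = algebraMap (𝓞 K) K n by simp, valuation_of_algebraMap, intValuation_eq_one_iff]

/-- `v(n) ≤ 1` for a natural number `n`. [folklore] -/
theorem valuation_natCast_le_one (v : HeightOneSpectrum (𝓞 K)) (n : ℕ) : v.valuation K (n : K) ≤ 1 := by
  rw [show (n : K) = algebraMap (𝓞 K) K n by simp]; exact valuation_le_one v _

/-- In `ℤᵐ⁰`: if `a, b ≤ 1` and `a · b = 1` then `a = 1` (and `b = 1`). [folklore] -/
theorem eq_one_of_mul_eq_one_of_le {a b : ℤᵐ⁰} (ha : a ≤ 1) (hb : b ≤ 1) (h : a * b = 1) :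
    a = 1 ∧ b = 1 := by
  have ha1 : a = 1 := by
    refine le_antisymm ha ?_
    calc 1 = a * b := h.symm
      _ ≤ a * 1 := by gcongr
      _ = a := mul_one a
  refine ⟨ha1, ?_⟩
  rwa [ha1, one_mul] at h

/-- **Away from `2` the `πᵢ` are units**: `v(πᵢ) = 1` if `2 ∉ v`. [folklore] -/
theorem valuation_πO_eq_one {v : HeightOneSpectrum (𝓞 K)} (h2 : (2 : 𝓞 K) ∉ v.asIdeal) (i : Fin 5) :
    v.valuation K ((πO i : 𝓞 K) : K) = 1 := by
  have hv2 : v.valuation K (2 : K) = 1 := by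
    exact_mod_cast (valuation_natCast_eq_one_iff v 2).mpr (by exact_mod_cast h2)
  have hm2 : v.valuation K (-2 : K) = 1 := by rw [Valuation.map_neg, hv2]
  have hle : ∀ j, v.valuation K ((πO j : 𝓞 K) : K) ≤ 1 := fun j => valuation_le_one v _
  have hprod : v.valuation K ((πO 0 : 𝓞 K) : K) * v.valuation K ((πO 1 : 𝓞 K) : K) *
      v.valuation K ((πO 2 : 𝓞 K) : K) * v.valuation K ((πO 3 : 𝓞 K) : K) *
      v.valuation K ((πO 4 : 𝓞 K) : K) = 1 := by
    rw [← map_mul, ← map_mul, ← map_mul, ← map_mul, ← map_mul, ← map_mul, ← map_mul, ← map_mul,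
      prod_πO, map_neg, map_ofNat, hm2]
  have l01 := mul_le_one' (hle 0) (hle 1)
  have l012 := mul_le_one' l01 (hle 2)
  have l0123 := mul_le_one' l012 (hle 3)
  obtain ⟨e0123, e4⟩ := eq_one_of_mul_eq_one_of_le l0123 (hle 4) hprod
  obtain ⟨e012, e3⟩ := eq_one_of_mul_eq_one_of_le l012 (hle 3) e0123
  obtain ⟨e01, e2⟩ := eq_one_of_mul_eq_one_of_le l01 (hle 2) e012
  obtain ⟨e0, e1⟩ := eq_one_of_mul_eq_one_of_le (hle 0) (hle 1) e01
  fin_cases i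
  exacts [e0, e1, e2, e3, e4]

/-- The valuation of a unit of `𝓞 K` is `1` at every finite place. [folklore] -/
theorem valuation_coe_unit (v : HeightOneSpectrum (𝓞 K)) (u : (𝓞 K)ˣ) :
    v.valuation K (((u : 𝓞 K)) : K) = 1 := by
  rw [RingOfIntegers.coe_eq_algebraMap, valuation_of_algebraMap, intValuation_eq_one_iff]
  exact fun h => v.isPrime.ne_top (Ideal.eq_top_of_isUnit_mem _ h u.isUnit)

/-- `v(cand n c) = 1` away from `2`. [folklore] -/
theorem valuation_cand_eq_one {v : HeightOneSpectrum (𝓞 K)} (h2 : (2 : 𝓞 K) ∉ v.asIdeal) (n c : Fin 32) :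
    v.valuation K ((cand n c : 𝓞 K) : K) = 1 := by
  rw [coe_cand, map_mul, map_prod, valuation_coe_unit, one_mul]
  refine Finset.prod_eq_one fun i _ => ?_
  rw [map_pow, valuation_πO_eq_one h2, one_pow]

/-! ### The inert primes `(3)`, `(5)`: `σ`-invariance of the valuation and norm parity -/

/-- The irreducibility certificate for `f mod 3` (`t⁹ - t` is a unit). [folklore] -/
theorem cert_three :
    (QuinticRing.powL [true, true] (QuinticRing.powL [true, true]
      (QuinticRing.gen (ZMod 3) (-512) (-1232) 212 96 (-1))) - QuinticRing.gen (ZMod 3) (-512) (-1232) 212 96 (-1)) *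
      (⟨1, -1, 1, -1, 0⟩ : QuinticRing (ZMod 3) (-512) (-1232) 212 96 (-1)) = 1 := by
  decide +kernel

/-- `f mod 3` is irreducible (the certificate `cert_three`). [folklore] -/
theorem irreducible_quinticPolyMod_three : Irreducible (quinticPolyMod 3) :=
  haveI : Fact (Nat.Prime 3) := ⟨Nat.prime_three⟩
  irreducible_quinticPolyMod_of_cert 3 (bs := [true, true]) (by decide) _ cert_three

/-- The irreducibility certificate for `f mod 5`. [folklore] -/
theorem cert_five :
    (QuinticRing.powL [true, false, true] (QuinticRing.powL [true, false, true]
      (QuinticRing.gen (ZMod 5) (-512) (-1232) 212 96 (-1))) - QuinticRing.gen (ZMod 5) (-512) (-1232) 212 96 (-1)) *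
      (⟨1, 1, 1, 2, -1⟩ : QuinticRing (ZMod 5) (-512) (-1232) 212 96 (-1)) = 1 := by
  decide +kernel

/-- `f mod 5` is irreducible (the certificate `cert_five`). [folklore] -/
theorem irreducible_quinticPolyMod_five : Irreducible (quinticPolyMod 5) :=
  haveI : Fact (Nat.Prime 5) := ⟨Nat.prime_five⟩
  irreducible_quinticPolyMod_of_cert 5 (bs := [true, false, true]) (by decide) _ cert_five

/-- `(3)` is prime and is the only prime above `3` (`f` irreducible modulo `3`, Dedekind–Kummer).
[folklore] -/
theorem span_three : (span {(3 : 𝓞 K)}).IsPrime ∧ ∀ P ∈ primesOver (span {(3 : ℤ)}) (𝓞 K), P = span {(3 : 𝓞 K)} := by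
  have h := span_natCast_of_irreducible Nat.prime_three (by norm_num) irreducible_quinticPolyMod_three
  exact ⟨by simpa using h.1, fun P hP => by simpa using h.2.2.2 P hP⟩

/-- `(5)` is prime and is the only prime above `5`. [folklore] -/
theorem span_five : (span {(5 : 𝓞 K)}).IsPrime ∧ ∀ P ∈ primesOver (span {(5 : ℤ)}) (𝓞 K), P = span {(5 : 𝓞 K)} := by
  have h := span_natCast_of_irreducible Nat.prime_five (by norm_num) irreducible_quinticPolyMod_five
  exact ⟨by simpa using h.1, fun P hP => by simpa using h.2.2.2 P hP⟩

/-- **A ring automorphism of `𝓞 K` does not increase the valuation at an inert prime `(p)`.**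
(Verbatim the tree's `CyclicQuintic11.intValuation_ringEquiv_le`.) [folklore] -/
theorem intValuation_ringEquiv_le (v : HeightOneSpectrum (𝓞 K)) {p : ℕ} (hv : v.asIdeal = span {(p : 𝓞 K)})
    (τ : 𝓞 K ≃+* 𝓞 K) (a : 𝓞 K) : v.intValuation (τ a) ≤ v.intValuation a := by
  by_cases ha : a = 0
  · simp [ha]
  have key : ∀ (b : 𝓞 K) (n : ℕ), v.intValuation b ≤ WithZero.exp (-(n : ℤ)) ↔ (p : 𝓞 K) ^ n ∣ b := by
    intro b n
    rw [intValuation_le_pow_iff_dvd, hv, Ideal.span_singleton_pow, dvd_span_singleton,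
      Ideal.mem_span_singleton]
  have hva : v.intValuation a ≠ 0 := intValuation_ne_zero v a ha
  obtain ⟨m, hm⟩ : ∃ m : ℕ, v.intValuation a = WithZero.exp (-(m : ℤ)) := by
    have hle : WithZero.log (v.intValuation a) ≤ 0 := by
      rw [← WithZero.log_one]
      exact (WithZero.log_le_log hva one_ne_zero).mpr (intValuation_le_one v a)
    refine ⟨(-WithZero.log (v.intValuation a)).toNat, ?_⟩
    rw [Int.toNat_of_nonneg (by omega), neg_neg, WithZero.exp_log hva]
  rw [hm, key]
  have h := (key a m).mp hm.le
  simpa using map_dvd τ h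

/-- `v_{(p)}(τ a) = v_{(p)}(a)` for a ring automorphism `τ` and an inert `p`. [folklore] -/
theorem intValuation_ringEquiv_eq (v : HeightOneSpectrum (𝓞 K)) {p : ℕ} (hv : v.asIdeal = span {(p : 𝓞 K)})
    (τ : 𝓞 K ≃+* 𝓞 K) (a : 𝓞 K) : v.intValuation (τ a) = v.intValuation a := by
  refine le_antisymm (intValuation_ringEquiv_le v hv τ a) ?_
  have := intValuation_ringEquiv_le v hv τ.symm (τ a)
  rwa [τ.symm_apply_apply] at this

/-- **`σ` preserves the valuation at an inert prime `(p)`.** [folklore] -/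
theorem valuation_σ_eq (v : HeightOneSpectrum (𝓞 K)) {p : ℕ} (hv : v.asIdeal = span {(p : 𝓞 K)}) (z : K) :
    v.valuation K (σ z) = v.valuation K z := by
  obtain ⟨a, b, hb, rfl⟩ := IsFractionRing.div_surjective (A := 𝓞 K) z
  have e : σ (algebraMap (𝓞 K) K a / algebraMap (𝓞 K) K b) =
      algebraMap (𝓞 K) K (σint a) / algebraMap (𝓞 K) K (σint b) := by
    rw [map_div₀]; rfl
  rw [e, map_div₀, map_div₀, valuation_of_algebraMap, valuation_of_algebraMap, valuation_of_algebraMap,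
    valuation_of_algebraMap, intValuation_ringEquiv_eq v hv, intValuation_ringEquiv_eq v hv]

/-- The same for iterates. [folklore] -/
theorem valuation_σ_iterate_eq (v : HeightOneSpectrum (𝓞 K)) {p : ℕ} (hv : v.asIdeal = span {(p : 𝓞 K)})
    (n : ℕ) (z : K) : v.valuation K (σ^[n] z) = v.valuation K z := by
  induction n with
  | zero => rfl
  | succ n ih => rw [Function.iterate_succ_apply', valuation_σ_eq v hv, ih]

/-- **Norm parity at an inert prime**: if `N_{K/ℚ}(z)` is a rational square then `ord_{(p)}(z)` is even
(`5·ord(z) = 2·ord(r)`). (Verbatim the tree's `CyclicQuintic11.two_dvd_log_valuation_of_isSquare_norm`.)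
[folklore] -/
theorem two_dvd_log_valuation_of_isSquare_norm (v : HeightOneSpectrum (𝓞 K)) {p : ℕ}
    (hv : v.asIdeal = span {(p : 𝓞 K)}) {z : K} (hz : z ≠ 0) (h : IsSquare (Algebra.norm ℚ z)) :
    (2 : ℤ) ∣ WithZero.log (v.valuation K z) := by
  obtain ⟨r, hr⟩ := h
  have hN := norm_eq_prod_pow_σ z
  rw [hr, map_mul] at hN
  set w := v.valuation K with hw
  have hσz : ∀ i : Fin 5, (σ ^ (i : ℕ)) z ≠ 0 := fun i => (_root_.map_ne_zero _).mpr hz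
  have hprod : ∏ i : Fin 5, (σ ^ (i : ℕ)) z ≠ 0 := Finset.prod_ne_zero_iff.mpr fun i _ => hσz i
  have hr0 : (algebraMap ℚ K r) ≠ 0 := by
    intro h0
    rw [h0, zero_mul] at hN
    exact hprod hN.symm
  have hv0 : w z ≠ 0 := (Valuation.ne_zero_iff _).mpr hz
  have hvr : w (algebraMap ℚ K r) ≠ 0 := (Valuation.ne_zero_iff _).mpr hr0
  have hwi : ∀ i : Fin 5, w ((σ ^ (i : ℕ)) z) = w z := fun i => by
    rw [hw, σ_pow_apply, valuation_σ_iterate_eq v hv]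
  have key : WithZero.log (w (algebraMap ℚ K r * algebraMap ℚ K r)) =
      WithZero.log (w (∏ i : Fin 5, (σ ^ (i : ℕ)) z)) := by rw [hN]
  rw [map_mul, WithZero.log_mul hvr hvr, map_prod] at key
  simp_rw [hwi] at key
  rw [Finset.prod_const, Finset.card_univ, Fintype.card_fin, WithZero.log_pow] at key
  exact ⟨3 * WithZero.log (w z) - WithZero.log (w (algebraMap ℚ K r)), by
    simp only [nsmul_eq_mul, Nat.cast_ofNat] at key; linarith⟩

/-! ### Norm parity at the split prime `2`: the total `2`-adic order is even -/

/-- **The total `2`-adic order is even**: if `N_{K/ℚ}(z) ∈ ℚˣ²` and `z` has classes `(nₛ, rₛ)` at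
`𝔭ₛ`, then `2 ∣ Σ nₛ` (`N(z) = ∏ σᵏz` has class `Σ nₖ` at `𝔭₀`). [folklore] -/
theorem two_dvd_sum_of_isSquare_norm {z : K} (hN : IsSquare (Algebra.norm ℚ z)) {n : Fin 5 → ℤ}
    {r : Fin 5 → ZMod 8} (h : ∀ s, LocQ (ρ s) z (n s) (r s)) : (2 : ℤ) ∣ ∑ s, n s := by
  obtain ⟨c, hc⟩ := hN
  have hN' := norm_eq_prod_pow_σ z
  rw [hc, map_mul] at hN'
  have hk : ∀ k : Fin 5, LocQ (ρ 0) ((σ ^ (k : ℕ)) z) (n k) (r k) := fun k => by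
    rw [σ_pow_apply]
    exact locQ_σ_iterate k (by rw [zero_add]; exact h k)
  have hprod := locQ_prod (ρ' := ρ 0) Finset.univ fun k _ => hk k
  rw [← hN'] at hprod
  have hc0 : (algebraMap ℚ K c) ≠ 0 := fun h0 => LocQ.ne_zero hprod (by rw [h0, zero_mul])
  obtain ⟨m, s, hm⟩ := exists_locQ (ρ := ρ 0) hc0
  have hsq := hm.sq
  rw [pow_two] at hsq
  obtain ⟨e, -⟩ := hprod.unique hsq
  exact ⟨m, by linarith⟩

/-! ### `K(∅, 2) = {rep n}` (class number one, units modulo squares) -/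

/-- **A non-zero `z ∈ K` all of whose valuations are even is `rep n · w²`** (the tree's
`exists_isSquare_mul_of_two_dvd_log_valuation` with `D = 1`; units modulo squares:
`exists_eq_rep_mul_sq`). (Verbatim the tree's `CyclicQuintic11.exists_rep_mul_sq_of_two_dvd_log_valuation`.)
[folklore] -/
theorem exists_rep_mul_sq_of_two_dvd_log_valuation {z : K} (hz : z ≠ 0)
    (hval : ∀ v : HeightOneSpectrum (𝓞 K), (2 : ℤ) ∣ WithZero.log (v.valuation K z)) :
    ∃ (n : Fin 32) (w : K), w ≠ 0 ∧ z = (((rep n : (𝓞 K)ˣ) : 𝓞 K) : K) * w ^ 2 := by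
  obtain ⟨u, l, hlG, -, r, hr⟩ :=
    Literature.NumberTheory.NumberFields.exists_isSquare_mul_of_two_dvd_log_valuation (1 : 𝓞 K) List.nil
    (fun q hq hd => (hq.not_unit (isUnit_of_dvd_one hd)).elim) hz (fun v _ => hval v)
  have hl : l = List.nil := List.eq_nil_iff_forall_not_mem.mpr fun g hg => by simpa using hlG g hg
  subst hl
  simp only [List.prod_nil] at hr
  rw [show (((1 : 𝓞 K)) : K) = 1 from rfl, mul_one] at hr
  obtain ⟨n, η, hu⟩ := exists_eq_rep_mul_sq u⁻¹
  have hu' : (((u⁻¹ : (𝓞 K)ˣ) : 𝓞 K) : K) = (((rep n : (𝓞 K)ˣ) : 𝓞 K) : K) * ((((η : (𝓞 K)ˣ) : 𝓞 K) : K)) ^ 2 := by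
    rw [hu]; simp only [Units.val_mul, Units.val_pow_eq_pow_val]; push_cast; ring
  have huu : (((u : (𝓞 K)ˣ) : 𝓞 K) : K) * (((u⁻¹ : (𝓞 K)ˣ) : 𝓞 K) : K) = 1 := by
    have h1 : ((((u * u⁻¹ : (𝓞 K)ˣ)) : 𝓞 K) : K) = 1 := by rw [mul_inv_cancel]; rfl
    push_cast at h1
    exact h1
  refine ⟨n, (((η : (𝓞 K)ˣ) : 𝓞 K) : K) * r, ?_, ?_⟩
  · intro h0
    apply hz
    have : z * (((u : (𝓞 K)ˣ) : 𝓞 K) : K) = 0 := by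
      rw [hr]
      rcases mul_eq_zero.mp h0 with h | h
      · exfalso
        exact (RingOfIntegers.coe_ne_zero_iff.mpr (Units.ne_zero η)) h
      · rw [h, mul_zero]
    rcases mul_eq_zero.mp this with h | h
    · exact h
    · exact absurd h (RingOfIntegers.coe_ne_zero_iff.mpr (Units.ne_zero u))
  · calc z = z * ((((u : (𝓞 K)ˣ) : 𝓞 K) : K) * (((u⁻¹ : (𝓞 K)ˣ) : 𝓞 K) : K)) := by rw [huu, mul_one]
      _ = (z * (((u : (𝓞 K)ˣ) : 𝓞 K) : K)) * (((u⁻¹ : (𝓞 K)ˣ) : 𝓞 K) : K) := by ring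
      _ = _ := by rw [hr, hu']; ring

/-! ### The curve `480a1 : y² = x(x + 2)(x - 3)` over `K` -/

section Curve

variable {x y : K} (hE : y ^ 2 = x * (x + 2) * (x - 3)) (hy : y ≠ 0)
include hE hy

/-- `x ≠ 0`, `x + 2 ≠ 0`, `x - 3 ≠ 0` for a point with `y ≠ 0`. [folklore] -/
theorem x_ne : x ≠ 0 ∧ x + 2 ≠ 0 ∧ x - 3 ≠ 0 := by
  have h : x * (x + 2) * (x - 3) ≠ 0 := by rw [← hE]; exact pow_ne_zero 2 hy
  exact ⟨fun h0 => h (by rw [h0]; ring), fun h0 => h (by rw [h0]; ring), fun h0 => h (by rw [h0]; ring)⟩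

/-- **`ord_v(x)` is even at every `v ∤ 2`**: at the inert `(3)` by `N(x) = □`, elsewhere by the
parity lemma (`e = (0, -2, 3)`). [folklore] -/
theorem two_dvd_log_valuation_x (hN : IsSquare (Algebra.norm ℚ x)) (v : HeightOneSpectrum (𝓞 K))
    (h2 : (2 : 𝓞 K) ∉ v.asIdeal) : (2 : ℤ) ∣ WithZero.log (v.valuation K x) := by
  obtain ⟨hx0, -, -⟩ := x_ne hE hy
  by_cases h3 : (3 : 𝓞 K) ∈ v.asIdeal
  · have hv : v.asIdeal = span {((3 : ℕ) : 𝓞 K)} := by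
      haveI := v.isPrime
      exact_mod_cast span_three.2 v.asIdeal (by simpa using mem_primesOver_of_mem Nat.prime_three (by simpa using h3))
    exact two_dvd_log_valuation_of_isSquare_norm v hv hx0 hN
  have hv2 : v.valuation K (2 : K) = 1 := by exact_mod_cast (valuation_natCast_eq_one_iff v 2).mpr (by exact_mod_cast h2)
  have hv3 : v.valuation K (3 : K) = 1 := by exact_mod_cast (valuation_natCast_eq_one_iff v 3).mpr (by exact_mod_cast h3)
  have key := (v.valuation K).two_dvd_log_map_sub_of_sq_eq (e₁ := 0) (e₂ := -2) (e₃ := 3) (x := x) (y := y)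
    (by rw [map_zero]; exact zero_le_one) (by simp only [Valuation.map_neg, hv2, le_refl]) (by rw [hv3])
    (by simp only [zero_sub, Valuation.map_neg, hv2]) (by simp only [zero_sub, Valuation.map_neg, hv3]) hx0
    (by rw [hE]; ring)
  rwa [sub_zero] at key

/-- **`ord_v(x + 2)` is even at every `v ∤ 2`**: at the inert `(5)` by `N(x + 2) = □`, elsewhere by
the parity lemma (`e = (-2, 0, 3)`). [folklore] -/
theorem two_dvd_log_valuation_x_add_two (hN : IsSquare (Algebra.norm ℚ (x + 2))) (v : HeightOneSpectrum (𝓞 K))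
    (h2 : (2 : 𝓞 K) ∉ v.asIdeal) : (2 : ℤ) ∣ WithZero.log (v.valuation K (x + 2)) := by
  obtain ⟨hx0, hx2, -⟩ := x_ne hE hy
  by_cases h5 : (5 : 𝓞 K) ∈ v.asIdeal
  · have hv : v.asIdeal = span {((5 : ℕ) : 𝓞 K)} := by
      haveI := v.isPrime
      exact_mod_cast span_five.2 v.asIdeal (by simpa using mem_primesOver_of_mem Nat.prime_five (by simpa using h5))
    exact two_dvd_log_valuation_of_isSquare_norm v hv hx2 hN
  have hv2 : v.valuation K (2 : K) = 1 := by exact_mod_cast (valuation_natCast_eq_one_iff v 2).mpr (by exact_mod_cast h2)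
  have hv5 : v.valuation K (5 : K) = 1 := by exact_mod_cast (valuation_natCast_eq_one_iff v 5).mpr (by exact_mod_cast h5)
  have hv3 : v.valuation K (3 : K) ≤ 1 := by exact_mod_cast valuation_natCast_le_one v 3
  have key := (v.valuation K).two_dvd_log_map_sub_of_sq_eq (e₁ := -2) (e₂ := 0) (e₃ := 3) (x := x) (y := y)
    (by simp only [Valuation.map_neg, hv2, le_refl]) (by rw [map_zero]; exact zero_le_one) hv3
    (by simp only [sub_zero, Valuation.map_neg, hv2])
    (by rw [show (-2 : K) - 3 = -5 by norm_num]; simp only [Valuation.map_neg, hv5])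
    (by rw [Ne, ← sub_eq_zero, sub_neg_eq_add]; exact hx2) (by rw [hE]; ring)
  rwa [sub_neg_eq_add] at key

omit hE hy in
/-- Every bit pattern is realised: for `f : Fin 5 → {0,1}` there is `c < 32` with `bit c i = f i`.
[folklore] -/
theorem exists_bits_eq : ∀ f0 f1 f2 f3 f4 : Fin 2, ∃ c : Fin 32,
    bit c 0 = f0 ∧ bit c 1 = f1 ∧ bit c 2 = f2 ∧ bit c 3 = f3 ∧ bit c 4 = f4 := by
  decide

omit hE hy in
/-- **Extraction of the class representative**: if `z ≠ 0` has even valuation at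
every `v ∤ 2`, then `z = cand n c · A²` (`bit c i ≡ ord_{𝔭_{1-i}}(z)`: `z/∏πᵢ^{cᵢ}` has all valuations
even, the class number is one, and the units are `rep n` modulo squares). [folklore] -/
theorem exists_eq_cand_mul_sq {z : K} (hz : z ≠ 0)
    (heven : ∀ v : HeightOneSpectrum (𝓞 K), (2 : 𝓞 K) ∉ v.asIdeal → (2 : ℤ) ∣ WithZero.log (v.valuation K z)) :
    ∃ (n c : Fin 32) (A : K), A ≠ 0 ∧ z = ((cand n c : 𝓞 K) : K) * A ^ 2 := by
  have hcl : ∀ s, ∃ (m : ℤ) (r : ZMod 8), LocQ (ρ s) z m r := fun s => exists_locQ (ρ := ρ s) hz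
  choose m r hmr using hcl
  -- parities
  have hpar : ∀ s, ∃ f : Fin 2, (2 : ℤ) ∣ m s - (f : ℕ) := fun s => by
    rcases Int.emod_two_eq_zero_or_one (m s) with h | h
    · exact ⟨0, by simp only [Fin.val_zero, Nat.cast_zero, sub_zero]; omega⟩
    · exact ⟨1, by simp only [Fin.val_one, Nat.cast_one]; omega⟩
  choose f hf using hpar
  obtain ⟨c, hc0, hc1, hc2, hc3, hc4⟩ := exists_bits_eq (f 1) (f 0) (f 4) (f 3) (f 2)
  have hbit : ∀ i : Fin 5, bit c i = f (1 - i) := by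
    intro i; fin_cases i
    exacts [hc0, hc1, hc2, hc3, hc4]
  have hbit : ∀ s : Fin 5, bit c (1 - s) = f s := by
    intro s; fin_cases s
    exacts [hc1, hc0, hc4, hc3, hc2]
  have hordOf : ∀ s : Fin 5, ordOf c s = (bit c (1 - s) : ℤ) := by
    intro s
    rw [ordOf, Fin.sum_univ_five]
    fin_cases s <;> simp [πord]
  have hord : ∀ s, (2 : ℤ) ∣ m s - ordOf c s := fun s => by rw [hordOf, hbit]; exact hf s
  have hγ0 : ((cand 0 c : 𝓞 K) : K) ≠ 0 := (locQ_cand 0 c 0).ne_zero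
  -- all valuations of `z/γ` are even
  have hall : ∀ v : HeightOneSpectrum (𝓞 K),
      (2 : ℤ) ∣ WithZero.log (v.valuation K (z / ((cand 0 c : 𝓞 K) : K))) := by
    intro v
    have hvz : v.valuation K z ≠ 0 := (Valuation.ne_zero_iff _).mpr hz
    have hvγ : v.valuation K ((cand 0 c : 𝓞 K) : K) ≠ 0 := (Valuation.ne_zero_iff _).mpr hγ0
    rw [map_div₀, WithZero.log_div hvz hvγ]
    by_cases h2 : (2 : 𝓞 K) ∈ v.asIdeal
    · obtain ⟨s, rfl⟩ := exists_eq_prime_of_two_mem h2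
      rw [(hmr s).log_valuation_eq, (locQ_cand 0 c s).log_valuation_eq]
      have := hord s
      omega
    · rw [valuation_cand_eq_one h2, WithZero.log_one, sub_zero]
      exact heven v h2
  obtain ⟨n, w', hw0, hw⟩ := exists_rep_mul_sq_of_two_dvd_log_valuation (div_ne_zero hz hγ0) hall
  refine ⟨n, c, w', hw0, ?_⟩
  have hz' : z = ((cand 0 c : 𝓞 K) : K) * ((((rep n : (𝓞 K)ˣ) : 𝓞 K) : K) * w' ^ 2) := by
    rw [← hw, mul_div_cancel₀ _ hγ0]
  rw [hz', coe_cand, coe_cand, rep_zero]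
  simp only [Units.val_one, map_one, one_mul]
  ring

omit hE hy in
/-- `N(σⁱ v) = 1`. [folklore] -/
theorem norm_unitv (i : Fin 5) : Algebra.norm ℚ (((unitv i : (𝓞 K)ˣ) : 𝓞 K) : K) = 1 := by
  rw [coe_unitv, coe_liftO, ← σ_iterate_liftK, ← σ_pow_apply, Algebra.norm_eq_of_algEquiv,
    norm_liftK_of_normP_eq normP_vP]
  norm_num

omit hE hy in
/-- **`N(cand n c) = (-1)^{b₄} · (-2)^{Σ bit c i}`.** [folklore] -/
theorem norm_cand (n c : Fin 32) :
    Algebra.norm ℚ ((cand n c : 𝓞 K) : K) = (-1) ^ bit n 4 * (-2) ^ ∑ i : Fin 5, bit c i := by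
  have hneg : Algebra.norm ℚ (-1 : K) = -1 := by
    rw [show (-1 : K) = algebraMap ℚ K (-1) by simp, Algebra.norm_algebraMap, finrank_K]; norm_num
  rw [coe_cand, rep]
  simp only [Units.val_mul, Units.val_pow_eq_pow_val, Units.val_neg, Units.val_one, Units.coe_prod,
    map_mul, map_pow, map_neg, map_one, map_prod, hneg, norm_unitv, norm_πO, one_pow,
    Finset.prod_const_one, mul_one, Finset.prod_pow_eq_pow_sum]

omit hE hy in
/-- `2` is not a square in `ℚ`. [folklore] -/
theorem not_isSquare_two : ¬ IsSquare (2 : ℚ) := by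
  rw [show (2 : ℚ) = ((2 : ℕ) : ℚ) by norm_num, Rat.isSquare_natCast_iff]
  rintro ⟨r, hr⟩
  have hr2 : r ≤ 2 := by nlinarith
  interval_cases r <;> omega

omit hE hy in
/-- **`(-1)^b · (-2)^w` is a rational square only if `b = 0` and `w` is even** (`b < 2`). [folklore] -/
theorem eq_zero_and_even_of_isSquare {b w : ℕ} (hb : b < 2) (h : IsSquare ((-1 : ℚ) ^ b * (-2) ^ w)) :
    b = 0 ∧ Even w := by
  obtain ⟨q, hq⟩ := h
  have hval : (-1 : ℚ) ^ b * (-2) ^ w = (-1) ^ (b + w) * 2 ^ w := by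
    rw [show (-2 : ℚ) = (-1) * 2 by norm_num, mul_pow, pow_add]; ring
  rw [hval] at hq
  rcases Nat.even_or_odd (b + w) with hbw | hbw
  · rw [hbw.neg_one_pow, one_mul] at hq
    rcases Nat.even_or_odd w with hw | hw
    · refine ⟨?_, hw⟩
      rcases Nat.even_or_odd b with hb' | hb'
      · obtain ⟨k, hk⟩ := hb'; omega
      · exact absurd (Nat.even_add.mp hbw |>.mpr hw) (Nat.not_even_iff_odd.mpr hb')
    · exfalso
      obtain ⟨k, rfl⟩ := hw
      apply not_isSquare_two
      have h2k : (2 : ℚ) ^ k ≠ 0 := pow_ne_zero _ two_ne_zero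
      refine ⟨q / 2 ^ k, ?_⟩
      rw [div_mul_div_comm, ← hq, eq_div_iff (mul_ne_zero h2k h2k)]
      ring
  · exfalso
    rw [hbw.neg_one_pow] at hq
    have h1 : 0 ≤ q * q := mul_self_nonneg q
    have h2 : (0 : ℚ) < 2 ^ w := by positivity
    linarith

omit hE hy in
/-- **The norm condition**: in `z = cand n c · A²` with `N(z) ∈ ℚˣ²`, the unit part has norm `1`
(`bit n 4 = 0`) and `Σ bit c i` is even. [folklore] -/
theorem parity_of_isSquare_norm {z : K} (hN : IsSquare (Algebra.norm ℚ z)) {n c : Fin 32} {A : K}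
    (hA : A ≠ 0) (hz : z = ((cand n c : 𝓞 K) : K) * A ^ 2) : bit n 4 = 0 ∧ 2 ∣ ∑ i : Fin 5, bit c i := by
  have hNz : Algebra.norm ℚ z = ((-1) ^ bit n 4 * (-2) ^ ∑ i : Fin 5, bit c i) * (Algebra.norm ℚ A) ^ 2 := by
    rw [hz, map_mul, map_pow, norm_cand]
  have hq : Algebra.norm ℚ A ≠ 0 := Algebra.norm_ne_zero_iff.mpr hA
  have hsq : IsSquare ((-1 : ℚ) ^ bit n 4 * (-2) ^ ∑ i : Fin 5, bit c i) := by
    obtain ⟨t, ht⟩ := hN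
    refine ⟨t / Algebra.norm ℚ A, ?_⟩
    rw [div_mul_div_comm, ← ht, hNz, eq_div_iff (mul_ne_zero hq hq)]
    ring
  have hb : bit n 4 < 2 := Nat.mod_lt _ two_pos
  obtain ⟨h0, hw⟩ := eq_zero_and_even_of_isSquare hb hsq
  exact ⟨h0, even_iff_two_dvd.mp hw⟩

/-- **`x + 2` is totally positive** for a `K`-point of `y² = x(x+2)(x-3)` with `y ≠ 0`.
(Verbatim the tree's `CyclicCubic1339A.sgn3_x_add_two`.) [folklore] -/
theorem sgn5_x_add_two : sgn5 (x + 2) = 1 := by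
  have h : ∀ e : K →+* ℝ, SignType.sign (e (x + 2)) = 1 := fun e => by
    rw [map_add, map_ofNat]
    have hEe := congrArg e hE
    simp only [map_pow, map_mul, map_add, map_sub, map_ofNat] at hEe
    have hye : e y ≠ 0 := (_root_.map_ne_zero e).mpr hy
    refine sign_pos ?_
    by_contra hle
    rw [not_lt] at hle
    have h1 : 0 < e x * (e x - 3) := by nlinarith
    have h3 : 0 < e y ^ 2 := lt_of_le_of_ne (sq_nonneg _) (Ne.symm (pow_ne_zero 2 hye))
    nlinarith
  ext s
  exact h (emb s)

end Curve

/-! ### The finite check and the assembly -/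

/-- **The finite check**: among the pairs of candidates `(cand n c, cand n' c')` with unit parts of
norm `1` and even `π`-weights, total positivity of the second and the five local conditions at
`𝔭₀, …, 𝔭₄` leave only the trivial pair (kernel computation; the sign condition is tested first, so
that only `16` second components reach the `2`-adic test). [folklore] -/
theorem final_check : ∀ n' c' : Fin 32, bit n' 4 = 0 → 2 ∣ ∑ i : Fin 5, bit c' i → sgnOf n' c' = 1 →
    ∀ n c : Fin 32, bit n 4 = 0 → 2 ∣ ∑ i : Fin 5, bit c i →
    (∀ s : Fin 5, W480 (ordOf c s) (ordOf c' s) (resOf n c s) (resOf n' c' s)) →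
    n = 0 ∧ c = 0 ∧ n' = 0 ∧ c' = 0 := by
  decide +kernel

/-- **The norm-`1` `2`-descent statement for `480a1` over the cyclic quintic field of conductor
`241` (in which `2` splits completely).** For every `K`-point `(x, y)`, `y ≠ 0`, of
`y² = x(x + 2)(x - 3)` such that `N_{K/ℚ}(x)` and `N_{K/ℚ}(x + 2)` are rational squares, `x` and
`x + 2` are squares in `K`. [cite: DokchitserDokchitser2011RankModN, proof of Thm. 2] -/
theorem normDescent {x y : K} (hE : y ^ 2 = x * (x + 2) * (x - 3)) (hy : y ≠ 0)
    (hNx : IsSquare (Algebra.norm ℚ x)) (hNx2 : IsSquare (Algebra.norm ℚ (x + 2))) :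
    IsSquare x ∧ IsSquare (x + 2) := by
  obtain ⟨hx0, hx2, -⟩ := x_ne hE hy
  obtain ⟨n, c, A, hA, hxA⟩ := exists_eq_cand_mul_sq hx0 (two_dvd_log_valuation_x hE hy hNx)
  obtain ⟨n', c', B, hB, hxB⟩ :=
    exists_eq_cand_mul_sq hx2 (two_dvd_log_valuation_x_add_two hE hy hNx2)
  obtain ⟨hn4, hcev⟩ := parity_of_isSquare_norm hNx hA hxA
  obtain ⟨hn4', hcev'⟩ := parity_of_isSquare_norm hNx2 hB hxB
  have W : ∀ s : Fin 5, W480 (ordOf c s) (ordOf c' s) (resOf n c s) (resOf n' c' s) := fun s =>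
    localImage hE hy hxA hxB (locQ_cand n c s) (locQ_cand n' c' s)
  have hs : sgnOf n' c' = 1 := by
    have h := sgn5_x_add_two hE hy
    rw [hxB, sgn5_mul, sgn5_sq hB, mul_one, sgn5_cand] at h
    exact h
  obtain ⟨rfl, rfl, rfl, rfl⟩ := final_check n' c' hn4' hcev' hs n c hn4 hcev W
  have h1 : ((cand 0 0 : 𝓞 K) : K) = 1 := by
    rw [coe_cand, rep_zero]
    simp [bit]
  rw [h1, one_mul] at hxA hxB
  exact ⟨⟨A, by rw [hxA, pow_two]⟩, ⟨B, by rw [hxB, pow_two]⟩⟩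

/-! ### Transport to any quintic field generated by a root of `f` -/

section Transport

variable {K' : Type*} [Field K'] [Algebra ℚ K']

/-- `f(z)` as the value of `aeval`. [folklore] -/
theorem aeval_quinticPolyRat (z : K') :
    aeval z quinticPolyRat = z ^ 5 + z ^ 4 - 96 * z ^ 3 - 212 * z ^ 2 + 1232 * z + 512 := by
  refine (aeval_map_algebraMap ℚ z quinticPoly).trans ?_
  rw [quinticPoly]
  simp only [map_add, map_sub, map_pow, map_mul, aeval_X, map_ofNat]

/-- **The homomorphism `K = ℚ[X]/(f) → K'`, `θ ↦ θ'`**, for a root `θ'` of `f` in a `ℚ`-algebra `K'`.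
[folklore] -/
def algHomOfRoot {θ' : K'} (h : θ' ^ 5 + θ' ^ 4 - 96 * θ' ^ 3 - 212 * θ' ^ 2 + 1232 * θ' + 512 = 0) :
    K →ₐ[ℚ] K' :=
  AdjoinRoot.liftAlgHom quinticPolyRat (Algebra.ofId ℚ K') θ'
    (show aeval θ' quinticPolyRat = 0 by rw [aeval_quinticPolyRat, h])

/-- `algHomOfRoot h θ = θ'`. [folklore] -/
theorem algHomOfRoot_θ {θ' : K'} (h : θ' ^ 5 + θ' ^ 4 - 96 * θ' ^ 3 - 212 * θ' ^ 2 + 1232 * θ' + 512 = 0) :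
    algHomOfRoot h θ = θ' :=
  AdjoinRoot.liftAlgHom_root _ _ _ _

/-- **`K ≃ₐ[ℚ] K'` for every quintic extension `K'/ℚ` containing a root of `f`.** [folklore] -/
def algEquivOfRoot (h5 : Module.finrank ℚ K' = 5) {θ' : K'}
    (h : θ' ^ 5 + θ' ^ 4 - 96 * θ' ^ 3 - 212 * θ' ^ 2 + 1232 * θ' + 512 = 0) : K ≃ₐ[ℚ] K' :=
  haveI : FiniteDimensional ℚ K' := Module.finite_of_finrank_eq_succ h5
  AlgEquiv.ofBijective (algHomOfRoot h)
    ⟨(algHomOfRoot h).toRingHom.injective,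
     (LinearMap.injective_iff_surjective_of_finrank_eq_finrank (f := (algHomOfRoot h).toLinearMap)
        (by rw [finrank_K, h5])).mp (algHomOfRoot h).toRingHom.injective⟩

/-- `algEquivOfRoot h5 h θ = θ'`. [folklore] -/
theorem algEquivOfRoot_θ (h5 : Module.finrank ℚ K' = 5) {θ' : K'}
    (h : θ' ^ 5 + θ' ^ 4 - 96 * θ' ^ 3 - 212 * θ' ^ 2 + 1232 * θ' + 512 = 0) :
    algEquivOfRoot h5 h θ = θ' :=
  algHomOfRoot_θ h

/-- Squares are preserved by ring isomorphisms. [folklore] -/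
theorem isSquare_map_of_isSquare (g : K ≃ₐ[ℚ] K') {z : K} (hz : IsSquare z) : IsSquare (g z) := by
  obtain ⟨r, hr⟩ := hz
  exact ⟨g r, by rw [hr, map_mul]⟩

/-- **Transport of `normDescent` along `K ≃ₐ[ℚ] K'`.** (Verbatim the tree's
`CyclicQuintic11.normDescent_of_algEquiv`.) [folklore] -/
theorem normDescent_of_algEquiv (g : K ≃ₐ[ℚ] K') {x y : K'} (hE : y ^ 2 = x * (x + 2) * (x - 3))
    (hy : y ≠ 0) (hNx : IsSquare (Algebra.norm ℚ x)) (hNx2 : IsSquare (Algebra.norm ℚ (x + 2))) :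
    IsSquare x ∧ IsSquare (x + 2) := by
  set x₀ := g.symm x with hx₀
  set y₀ := g.symm y with hy₀
  have hx : x = g x₀ := (g.apply_symm_apply x).symm
  have hyy : y = g y₀ := (g.apply_symm_apply y).symm
  have hE₀ : y₀ ^ 2 = x₀ * (x₀ + 2) * (x₀ - 3) := by
    apply g.injective
    rw [map_pow, map_mul, map_mul, map_add, map_sub, map_ofNat, map_ofNat, ← hx, ← hyy, hE]
  have hy₀' : y₀ ≠ 0 := fun h => hy (by rw [hyy, h, map_zero])
  have hN₀ : Algebra.norm ℚ x₀ = Algebra.norm ℚ x := by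
    rw [hx, Algebra.norm_eq_of_algEquiv g x₀]
  have hN₂ : Algebra.norm ℚ (x₀ + 2) = Algebra.norm ℚ (x + 2) := by
    rw [← Algebra.norm_eq_of_algEquiv g (x₀ + 2), map_add, map_ofNat, ← hx]
  obtain ⟨h1, h2⟩ := normDescent hE₀ hy₀' (hN₀ ▸ hNx) (hN₂ ▸ hNx2)
  refine ⟨hx ▸ isSquare_map_of_isSquare g h1, ?_⟩
  have : x + 2 = g (x₀ + 2) := by rw [map_add, map_ofNat, ← hx]
  rw [this]
  exact isSquare_map_of_isSquare g h2

/-- **The norm-`1` `2`-descent of `480a1` over ANY quintic extension `K'/ℚ` generated by a root of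
`f = X⁵ + X⁴ - 96X³ - 212X² + 1232X + 512`** (i.e. over any copy of the cyclic quintic field of
conductor `241`, e.g. as a subfield of `ℚ(ζ₂₆₅₁)`): points `(x, y)`, `y ≠ 0`, of `y² = x(x+2)(x-3)` with
`N(x)`, `N(x + 2) ∈ ℚ²` have `x`, `x + 2 ∈ K'²`. [folklore] -/
theorem normDescent_of_root (h5 : Module.finrank ℚ K' = 5) {θ' : K'}
    (hθ' : θ' ^ 5 + θ' ^ 4 - 96 * θ' ^ 3 - 212 * θ' ^ 2 + 1232 * θ' + 512 = 0) {x y : K'}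
    (hE : y ^ 2 = x * (x + 2) * (x - 3)) (hy : y ≠ 0) (hNx : IsSquare (Algebra.norm ℚ x))
    (hNx2 : IsSquare (Algebra.norm ℚ (x + 2))) : IsSquare x ∧ IsSquare (x + 2) :=
  normDescent_of_algEquiv (algEquivOfRoot h5 hθ') hE hy hNx hNx2

end Transport


end CyclicQuintic241

end Literature.NumberTheory.NumberFields

end
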